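import Summits.CriticalPhenomena.PercolationContinuityZ3.Theorems.PercNearOneGluingAdditiveGluingTiedRaiseGainEvent
import HarnessLib

/-!
# Crux `PercNearOneGluing.AdditiveGluing` (stmt-CriticalPhenomena-4576): the tied-raise lemma TRL₃' in the DEGENERATE case of zero φ-mass

Support file (`--supports stmt-CriticalPhenomena-4576`, lead prim-png-lead-4576).  No definitions, no named facts, no sorries.

Complement to `tiedRaiseThreeInf_of_phi` (which needs a positive total φ-mass): if the observer `o` is NEVER joined to a relay that is
separated from the other two — `μ(o↔a_l ∩ N_l) = 0` for `l = 1,2,3` — then for every internal pair `e = {a_i,a_j}` the pivotal event of `e`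
for `o ↔ b` is contained, up to these null events, in the pivotal event of `e` for the third relay `a_k ↔ b`
(`tiedRaise_pivotalEvent_subset`), so `g_o(e) ≤ g_{a_k}(e) ≤ π_e` and the observer's total rate is at most the common rate `ρ`
(`tiedRaiseThreeInf_of_zeroPhi`).  Together the two files give: at a three-way tie with internal weights `< 1` and non-null separation events
`N_l`, the registered kernel `stub_phiTiedRaiseThree_pl` implies the registered kernel `stub_tiedRaiseThreeInf_pl`.
[cite: KozmaNitzan2024, Lemma 4 / eq. (8) (p. 9)]
-/

namespace Summit.CriticalPhenomena.PercolationContinuityZ3.Theorems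

open MeasureTheory Set Literature.Probability.LatticeModels Literature.Probability.Percolation

noncomputable section
open Classical

variable {n : ℕ}

/-- Pointwise: the pivotal event of the pair `{a₁,a₂}` for `o↔b` lies in the pivotal event for `a₃↔b`, or `o` is joined to `a₁` separated
from `a₂,a₃`, or `o` is joined to `a₂` separated from `a₁,a₃`. [folklore] -/
theorem tiedRaise_pivotalEvent_subset (o b a₁ a₂ a₃ : Fin n) :
    ((openConn o b)ᶜ ∩ ((openConn o a₁ ∪ openConn o a₂) ∩ (openConn a₁ b ∪ openConn a₂ b)) : Set (BondConfig (Fin n))) ⊆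
      ((openConn a₃ b)ᶜ ∩ ((openConn a₃ a₁ ∪ openConn a₃ a₂) ∩ (openConn a₁ b ∪ openConn a₂ b))) ∪
        (openConn o a₁ ∩ ((openConn a₁ a₂)ᶜ ∩ (openConn a₁ a₃)ᶜ)) ∪ (openConn o a₂ ∩ ((openConn a₂ a₁)ᶜ ∩ (openConn a₂ a₃)ᶜ)) := by
  intro ω hω
  rcases hω with ⟨hob, hoa, hab⟩
  simp only [Set.mem_compl_iff] at hob
  simp only [Set.mem_union, Set.mem_inter_iff, Set.mem_compl_iff]
  rcases hoa with ho1 | ho2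
  · -- o ↔ a₁
    by_cases h12 : ω ∈ (openConn a₁ a₂ : Set (BondConfig (Fin n)))
    · exfalso
      rcases hab with h1b | h2b
      · exact hob (SimpleGraph.Reachable.trans ho1 h1b)
      · exact hob (SimpleGraph.Reachable.trans ho1 (SimpleGraph.Reachable.trans h12 h2b))
    by_cases h13 : ω ∈ (openConn a₁ a₃ : Set (BondConfig (Fin n)))
    · left; left
      refine ⟨fun h3b => hob (SimpleGraph.Reachable.trans ho1 (SimpleGraph.Reachable.trans h13 h3b)), ?_, hab⟩
      exact Or.inl (SimpleGraph.Reachable.symm h13)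
    · left; right
      exact ⟨ho1, h12, h13⟩
  · -- o ↔ a₂
    by_cases h21 : ω ∈ (openConn a₂ a₁ : Set (BondConfig (Fin n)))
    · exfalso
      rcases hab with h1b | h2b
      · exact hob (SimpleGraph.Reachable.trans ho2 (SimpleGraph.Reachable.trans h21 h1b))
      · exact hob (SimpleGraph.Reachable.trans ho2 h2b)
    by_cases h23 : ω ∈ (openConn a₂ a₃ : Set (BondConfig (Fin n)))
    · left; left
      refine ⟨fun h3b => hob (SimpleGraph.Reachable.trans ho2 (SimpleGraph.Reachable.trans h23 h3b)), ?_, hab⟩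
      exact Or.inr (SimpleGraph.Reachable.symm h23)
    · right
      exact ⟨ho2, h21, h23⟩

/-- Under zero φ-mass of `o` at `a₁` and `a₂`, the observer gains from the pair `{a₁,a₂}` at most at the rate of the third relay:
`g_o(s(a₁,a₂)) ≤ g_{a₃}(s(a₁,a₂))` (`w s(a₁,a₂) < 1`). [cite: KozmaNitzan2024, eq. (8) (p. 9)] -/
theorem tiedRaise_rate_le_third_of_zeroPhi (w : Sym2 (Fin n) → unitInterval) (o b a₁ a₂ a₃ : Fin n) (h12 : a₁ ≠ a₂)
    (hw : (w s(a₁, a₂) : ℝ) < 1)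
    (hz1 : (prodBernoulli w).real (openConn o a₁ ∩ ((openConn a₁ a₂)ᶜ ∩ (openConn a₁ a₃)ᶜ) : Set (BondConfig (Fin n))) = 0)
    (hz2 : (prodBernoulli w).real (openConn o a₂ ∩ ((openConn a₂ a₁)ᶜ ∩ (openConn a₂ a₃)ᶜ) : Set (BondConfig (Fin n))) = 0) :
    (prodBernoulli (Function.update w s(a₁, a₂) 1)).real (openConn o b) - (prodBernoulli (Function.update w s(a₁, a₂) 0)).real (openConn o b) ≤
      (prodBernoulli (Function.update w s(a₁, a₂) 1)).real (openConn a₃ b) - (prodBernoulli (Function.update w s(a₁, a₂) 0)).real (openConn a₃ b) := by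
  have hm : ∀ s : Set (BondConfig (Fin n)), MeasurableSet s := fun _ => MeasurableSet.of_discrete
  have ho := tiedRaise_rate_eq_event w h12 o b
  have h3 := tiedRaise_rate_eq_event w h12 a₃ b
  -- measure of the o-event ≤ measure of the a₃-event + 0 + 0
  have hsub := tiedRaise_pivotalEvent_subset o b a₁ a₂ a₃ (n := n)
  have hle : (prodBernoulli w).real ((openConn o b)ᶜ ∩ ((openConn o a₁ ∪ openConn o a₂) ∩ (openConn a₁ b ∪ openConn a₂ b)) :
      Set (BondConfig (Fin n))) ≤
      (prodBernoulli w).real ((openConn a₃ b)ᶜ ∩ ((openConn a₃ a₁ ∪ openConn a₃ a₂) ∩ (openConn a₁ b ∪ openConn a₂ b)) :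
        Set (BondConfig (Fin n))) := by
    refine (measureReal_mono hsub (measure_ne_top _ _)).trans ?_
    refine (measureReal_union_le _ _).trans ?_
    rw [hz2, add_zero]
    refine (measureReal_union_le _ _).trans ?_
    rw [hz1, add_zero]
  rw [← ho, ← h3] at hle
  have hpos : 0 < 1 - (w s(a₁, a₂) : ℝ) := by linarith
  exact le_of_mul_le_mul_left hle hpos

/-- **TRL₃' in the degenerate case of zero φ-mass**: at a three-way tie with internal weights `< 1`, if `μ(o↔a_l ∩ N_l) = 0` for
`l = 1,2,3` then for nonnegative pair weights with common relay rate `ρ` (the rate equation of `a₁` suffices) the observer's rate is `≤ ρ`.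
[cite: KozmaNitzan2024, Lemma 4 (p. 9)] -/
theorem tiedRaiseThreeInf_of_zeroPhi (w : Sym2 (Fin n) → unitInterval) (o b a₁ a₂ a₃ : Fin n) (x₁₂ x₁₃ x₂₃ ρ : ℝ)
    (h12 : a₁ ≠ a₂) (h13 : a₁ ≠ a₃) (h23 : a₂ ≠ a₃)
    (ht12 : (prodBernoulli w).real (openConn a₁ b) = (prodBernoulli w).real (openConn a₂ b))
    (ht13 : (prodBernoulli w).real (openConn a₁ b) = (prodBernoulli w).real (openConn a₃ b))
    (hx12 : 0 ≤ x₁₂) (hx13 : 0 ≤ x₁₃) (hx23 : 0 ≤ x₂₃)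
    (hr1 : x₁₂ * ((prodBernoulli (Function.update w s(a₁, a₂) 1)).real (openConn a₁ b) - (prodBernoulli (Function.update w s(a₁, a₂) 0)).real (openConn a₁ b)) + x₁₃ * ((prodBernoulli (Function.update w s(a₁, a₃) 1)).real (openConn a₁ b) - (prodBernoulli (Function.update w s(a₁, a₃) 0)).real (openConn a₁ b)) + x₂₃ * ((prodBernoulli (Function.update w s(a₂, a₃) 1)).real (openConn a₁ b) - (prodBernoulli (Function.update w s(a₂, a₃) 0)).real (openConn a₁ b)) = ρ)
    (hw12 : (w s(a₁, a₂) : ℝ) < 1) (hw13 : (w s(a₁, a₃) : ℝ) < 1) (hw23 : (w s(a₂, a₃) : ℝ) < 1)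
    (hz1 : (prodBernoulli w).real (openConn o a₁ ∩ ((openConn a₁ a₂)ᶜ ∩ (openConn a₁ a₃)ᶜ) : Set (BondConfig (Fin n))) = 0)
    (hz2 : (prodBernoulli w).real (openConn o a₂ ∩ ((openConn a₂ a₁)ᶜ ∩ (openConn a₂ a₃)ᶜ) : Set (BondConfig (Fin n))) = 0)
    (hz3 : (prodBernoulli w).real (openConn o a₃ ∩ ((openConn a₃ a₁)ᶜ ∩ (openConn a₃ a₂)ᶜ) : Set (BondConfig (Fin n))) = 0) :
    x₁₂ * ((prodBernoulli (Function.update w s(a₁, a₂) 1)).real (openConn o b) - (prodBernoulli (Function.update w s(a₁, a₂) 0)).real (openConn o b)) + x₁₃ * ((prodBernoulli (Function.update w s(a₁, a₃) 1)).real (openConn o b) - (prodBernoulli (Function.update w s(a₁, a₃) 0)).real (openConn o b)) + x₂₃ * ((prodBernoulli (Function.update w s(a₂, a₃) 1)).real (openConn o b) - (prodBernoulli (Function.update w s(a₂, a₃) 0)).real (openConn o b)) ≤ ρ := by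
  -- symmetric forms of the null hypotheses
  have hN1c : (openConn o a₁ ∩ ((openConn a₁ a₃)ᶜ ∩ (openConn a₁ a₂)ᶜ) : Set (BondConfig (Fin n))) =
      openConn o a₁ ∩ ((openConn a₁ a₂)ᶜ ∩ (openConn a₁ a₃)ᶜ) := by rw [Set.inter_comm (openConn a₁ a₃ : Set (BondConfig (Fin n)))ᶜ]
  have hN2c : (openConn o a₂ ∩ ((openConn a₂ a₃)ᶜ ∩ (openConn a₂ a₁)ᶜ) : Set (BondConfig (Fin n))) =
      openConn o a₂ ∩ ((openConn a₂ a₁)ᶜ ∩ (openConn a₂ a₃)ᶜ) := by rw [Set.inter_comm (openConn a₂ a₃ : Set (BondConfig (Fin n)))ᶜ]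
  have hN3c : (openConn o a₃ ∩ ((openConn a₃ a₂)ᶜ ∩ (openConn a₃ a₁)ᶜ) : Set (BondConfig (Fin n))) =
      openConn o a₃ ∩ ((openConn a₃ a₁)ᶜ ∩ (openConn a₃ a₂)ᶜ) := by rw [Set.inter_comm (openConn a₃ a₂ : Set (BondConfig (Fin n)))ᶜ]
  have hz1' : (prodBernoulli w).real (openConn o a₁ ∩ ((openConn a₁ a₃)ᶜ ∩ (openConn a₁ a₂)ᶜ) : Set (BondConfig (Fin n))) = 0 := by
    rw [hN1c]; exact hz1
  have hz2' : (prodBernoulli w).real (openConn o a₂ ∩ ((openConn a₂ a₃)ᶜ ∩ (openConn a₂ a₁)ᶜ) : Set (BondConfig (Fin n))) = 0 := by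
    rw [hN2c]; exact hz2
  have hz3' : (prodBernoulli w).real (openConn o a₃ ∩ ((openConn a₃ a₂)ᶜ ∩ (openConn a₃ a₁)ᶜ) : Set (BondConfig (Fin n))) = 0 := by
    rw [hN3c]; exact hz3
  have ht23 : (prodBernoulli w).real (openConn a₂ b) = (prodBernoulli w).real (openConn a₃ b) := by rw [← ht12, ht13]
  -- o's rate on each pair ≤ the third relay's rate ≤ the pair's common rate
  have o12 := tiedRaise_rate_le_third_of_zeroPhi w o b a₁ a₂ a₃ h12 hw12 hz1 hz2
  have o13 := tiedRaise_rate_le_third_of_zeroPhi w o b a₁ a₃ a₂ h13 hw13 hz1' hz3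
  have o23 := tiedRaise_rate_le_third_of_zeroPhi w o b a₂ a₃ a₁ h23 hw23 hz2' hz3'
  have k12 := tiedRaise_rate_le w h12 a₃ b ht12.le hw12
  have k13 := tiedRaise_rate_le w h13 a₂ b ht13.le hw13
  have c23 := tiedRaise_rate_eq_of_tie w h23 b ht23 hw23
  have k23 := tiedRaise_rate_le w h23 a₁ b ht23.le hw23
  rw [← hr1]
  nlinarith [mul_le_mul_of_nonneg_left o12 hx12, mul_le_mul_of_nonneg_left o13 hx13, mul_le_mul_of_nonneg_left o23 hx23,
    mul_le_mul_of_nonneg_left k12 hx12, mul_le_mul_of_nonneg_left k13 hx13, mul_le_mul_of_nonneg_left k23 hx23, c23]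

/-- **Φ-TRL₃ ⟹ TRL₃' at a non-degenerate three-way tie** (internal weights `< 1`, separation events `N_l` non-null): case split on the
observer's total φ-mass between `tiedRaiseThreeInf_of_phi` (positive mass) and `tiedRaiseThreeInf_of_zeroPhi` (zero mass).
[cite: KozmaNitzan2024, Lemma 4 (p. 9), Lemma 2 (p. 6)] -/
theorem tiedRaiseThreeInf_of_phi_nondeg
    (hΦ : ∀ (n : ℕ) (w : Sym2 (Fin n) → unitInterval) (o b a₁ a₂ a₃ : Fin n), a₁ ≠ a₂ → a₁ ≠ a₃ → a₂ ≠ a₃ → (prodBernoulli w).real (openConn a₁ b) = (prodBernoulli w).real (openConn a₂ b) → (prodBernoulli w).real (openConn a₁ b) = (prodBernoulli w).real (openConn a₃ b) → (prodBernoulli w).real (openConn o a₃ ∩ ((openConn a₃ a₁)ᶜ ∩ (openConn a₃ a₂)ᶜ : Set (BondConfig (Fin n)))) * (prodBernoulli w).real ((openConn a₁ a₂)ᶜ ∩ (openConn a₁ a₃)ᶜ : Set (BondConfig (Fin n))) * (prodBernoulli w).real ((openConn a₂ a₁)ᶜ ∩ (openConn a₂ a₃)ᶜ : Set (BondConfig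 (Fin n))) * (((prodBernoulli (Function.update w s(a₁, a₂) 1)).real (openConn a₁ b) - (prodBernoulli (Function.update w s(a₁, a₂) 0)).real (openConn a₁ b)) - ((prodBernoulli (Function.update w s(a₁, a₂) 1)).real (openConn a₃ b) - (prodBernoulli (Function.update w s(a₁, a₂) 0)).real (openConn a₃ b))) ≤ ((prodBernoulli w).real (openConn o a₁ ∩ ((openConn a₁ a₂)ᶜ ∩ (openConn a₁ a₃)ᶜ : Set (BondConfig (Fin n)))) * (prodBernoulli w).real ((openConn a₂ a₁)ᶜ ∩ (openConn a₂ a₃)ᶜ : Set (BondConfig (Fin n))) * (prodBernoulli w).real ((openConn a₃ a₁)ᶜ ∩ (openConn a₃ a₂)ᶜ : Set (BondConfig (Fin n))) + (prodBernoulli w).real (openConn o a₂ ∩ ((openConn a₂ a₁)ᶜ ∩ (openConn a₂ a₃)ᶜ : Set (BondConfig (Fin n)))) * (prodBernoulli w).real ((openConn a₁ a₂)ᶜ ∩ (openConn a₁ a₃)ᶜ : Set (BondConfig (Fin n))) * (prodBernoulli w).real ((openConn a₃ a₁)ᶜ ∩ (openConn a₃ a₂)ᶜ : Set (BondConfig (Fin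 n))) + (prodBernoulli w).real (openConn o a₃ ∩ ((openConn a₃ a₁)ᶜ ∩ (openConn a₃ a₂)ᶜ : Set (BondConfig (Fin n)))) * (prodBernoulli w).real ((openConn a₁ a₂)ᶜ ∩ (openConn a₁ a₃)ᶜ : Set (BondConfig (Fin n))) * (prodBernoulli w).real ((openConn a₂ a₁)ᶜ ∩ (openConn a₂ a₃)ᶜ : Set (BondConfig (Fin n)))) * (((prodBernoulli (Function.update w s(a₁, a₂) 1)).real (openConn a₁ b) - (prodBernoulli (Function.update w s(a₁, a₂) 0)).real (openConn a₁ b)) - ((prodBernoulli (Function.update w s(a₁, a₂) 1)).real (openConn o b) - (prodBernoulli (Function.update w s(a₁, a₂) 0)).real (openConn o b))))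
    (n : ℕ) (w : Sym2 (Fin n) → unitInterval) (o b a₁ a₂ a₃ : Fin n) (x₁₂ x₁₃ x₂₃ ρ : ℝ)
    (h12 : a₁ ≠ a₂) (h13 : a₁ ≠ a₃) (h23 : a₂ ≠ a₃)
    (ht12 : (prodBernoulli w).real (openConn a₁ b) = (prodBernoulli w).real (openConn a₂ b))
    (ht13 : (prodBernoulli w).real (openConn a₁ b) = (prodBernoulli w).real (openConn a₃ b))
    (hx12 : 0 ≤ x₁₂) (hx13 : 0 ≤ x₁₃) (hx23 : 0 ≤ x₂₃)
    (hr1 : x₁₂ * ((prodBernoulli (Function.update w s(a₁, a₂) 1)).real (openConn a₁ b) - (prodBernoulli (Function.update w s(a₁, a₂) 0)).real (openConn a₁ b)) + x₁₃ * ((prodBernoulli (Function.update w s(a₁, a₃) 1)).real (openConn a₁ b) - (prodBernoulli (Function.update w s(a₁, a₃) 0)).real (openConn a₁ b)) + x₂₃ * ((prodBernoulli (Function.update w s(a₂, a₃) 1)).real (openConn a₁ b) - (prodBernoulli (Function.update w s(a₂, a₃) 0)).real (openConn a₁ b)) = ρ) (hr2 : x₁₂ * ((prodBernoulli (Function.update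 w s(a₁, a₂) 1)).real (openConn a₂ b) - (prodBernoulli (Function.update w s(a₁, a₂) 0)).real (openConn a₂ b)) + x₁₃ * ((prodBernoulli (Function.update w s(a₁, a₃) 1)).real (openConn a₂ b) - (prodBernoulli (Function.update w s(a₁, a₃) 0)).real (openConn a₂ b)) + x₂₃ * ((prodBernoulli (Function.update w s(a₂, a₃) 1)).real (openConn a₂ b) - (prodBernoulli (Function.update w s(a₂, a₃) 0)).real (openConn a₂ b)) = ρ) (hr3 : x₁₂ * ((prodBernoulli (Function.update w s(a₁, a₂) 1)).real (openConn a₃ b) - (prodBernoulli (Function.update w s(a₁, a₂) 0)).real (openConn a₃ b)) + x₁₃ * ((prodBernoulli (Function.update w s(a₁, a₃) 1)).real (openConn a₃ b) - (prodBernoulli (Function.update w s(a₁, a₃) 0)).real (openConn a₃ b)) + x₂₃ * ((prodBernoulli (Function.update w s(a₂, a₃) 1)).real (openConn a₃ b) - (prodBernoulli (Function.update w s(a₂, a₃) 0)).real (openConn a₃ b)) = ρ)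
    (hw12 : (w s(a₁, a₂) : ℝ) < 1) (hw13 : (w s(a₁, a₃) : ℝ) < 1) (hw23 : (w s(a₂, a₃) : ℝ) < 1)
    (hN1 : 0 < (prodBernoulli w).real ((openConn a₁ a₂)ᶜ ∩ (openConn a₁ a₃)ᶜ : Set (BondConfig (Fin n)))) (hN2 : 0 < (prodBernoulli w).real ((openConn a₂ a₁)ᶜ ∩ (openConn a₂ a₃)ᶜ : Set (BondConfig (Fin n)))) (hN3 : 0 < (prodBernoulli w).real ((openConn a₃ a₁)ᶜ ∩ (openConn a₃ a₂)ᶜ : Set (BondConfig (Fin n)))) :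
    x₁₂ * ((prodBernoulli (Function.update w s(a₁, a₂) 1)).real (openConn o b) - (prodBernoulli (Function.update w s(a₁, a₂) 0)).real (openConn o b)) + x₁₃ * ((prodBernoulli (Function.update w s(a₁, a₃) 1)).real (openConn o b) - (prodBernoulli (Function.update w s(a₁, a₃) 0)).real (openConn o b)) + x₂₃ * ((prodBernoulli (Function.update w s(a₂, a₃) 1)).real (openConn o b) - (prodBernoulli (Function.update w s(a₂, a₃) 0)).real (openConn o b)) ≤ ρ := by
  by_cases hS : 0 < ((prodBernoulli w).real (openConn o a₁ ∩ ((openConn a₁ a₂)ᶜ ∩ (openConn a₁ a₃)ᶜ : Set (BondConfig (Fin n)))) * (prodBernoulli w).real ((openConn a₂ a₁)ᶜ ∩ (openConn a₂ a₃)ᶜ : Set (BondConfig (Fin n))) * (prodBernoulli w).real ((openConn a₃ a₁)ᶜ ∩ (openConn a₃ a₂)ᶜ : Set (BondConfig (Fin n)))) + ((prodBernoulli w).real (openConn o a₂ ∩ ((openConn a₂ a₁)ᶜ ∩ (openConn a₂ a₃)ᶜ : Set (BondConfig (Fin n)))) * (prodBernoulli w).real ((openConn a₁ a₂)ᶜ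 ∩ (openConn a₁ a₃)ᶜ : Set (BondConfig (Fin n))) * (prodBernoulli w).real ((openConn a₃ a₁)ᶜ ∩ (openConn a₃ a₂)ᶜ : Set (BondConfig (Fin n)))) + ((prodBernoulli w).real (openConn o a₃ ∩ ((openConn a₃ a₁)ᶜ ∩ (openConn a₃ a₂)ᶜ : Set (BondConfig (Fin n)))) * (prodBernoulli w).real ((openConn a₁ a₂)ᶜ ∩ (openConn a₁ a₃)ᶜ : Set (BondConfig (Fin n))) * (prodBernoulli w).real ((openConn a₂ a₁)ᶜ ∩ (openConn a₂ a₃)ᶜ : Set (BondConfig (Fin n))))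
  · exact tiedRaiseThreeInf_of_phi hΦ n w o b a₁ a₂ a₃ x₁₂ x₁₃ x₂₃ ρ h12 h13 h23 ht12 ht13 hx12 hx13 hx23 hr1 hr2 hr3 hw12 hw13 hw23 hS
  · -- zero total mass: each summand vanishes, hence each attachment mass vanishes
    have m0 : ∀ s : Set (BondConfig (Fin n)), 0 ≤ (prodBernoulli w).real s := fun _ => measureReal_nonneg
    have hΦ1 : 0 ≤ ((prodBernoulli w).real (openConn o a₁ ∩ ((openConn a₁ a₂)ᶜ ∩ (openConn a₁ a₃)ᶜ : Set (BondConfig (Fin n)))) * (prodBernoulli w).real ((openConn a₂ a₁)ᶜ ∩ (openConn a₂ a₃)ᶜ : Set (BondConfig (Fin n))) * (prodBernoulli w).real ((openConn a₃ a₁)ᶜ ∩ (openConn a₃ a₂)ᶜ : Set (BondConfig (Fin n)))) := mul_nonneg (mul_nonneg (m0 _) (m0 _)) (m0 _)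
    have hΦ2 : 0 ≤ ((prodBernoulli w).real (openConn o a₂ ∩ ((openConn a₂ a₁)ᶜ ∩ (openConn a₂ a₃)ᶜ : Set (BondConfig (Fin n)))) * (prodBernoulli w).real ((openConn a₁ a₂)ᶜ ∩ (openConn a₁ a₃)ᶜ : Set (BondConfig (Fin n))) * (prodBernoulli w).real ((openConn a₃ a₁)ᶜ ∩ (openConn a₃ a₂)ᶜ : Set (BondConfig (Fin n)))) := mul_nonneg (mul_nonneg (m0 _) (m0 _)) (m0 _)
    have hΦ3 : 0 ≤ ((prodBernoulli w).real (openConn o a₃ ∩ ((openConn a₃ a₁)ᶜ ∩ (openConn a₃ a₂)ᶜ : Set (BondConfig (Fin n)))) * (prodBernoulli w).real ((openConn a₁ a₂)ᶜ ∩ (openConn a₁ a₃)ᶜ : Set (BondConfig (Fin n))) * (prodBernoulli w).real ((openConn a₂ a₁)ᶜ ∩ (openConn a₂ a₃)ᶜ : Set (BondConfig (Fin n)))) := mul_nonneg (mul_nonneg (m0 _) (m0 _)) (m0 _)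
    have hS0 : ((prodBernoulli w).real (openConn o a₁ ∩ ((openConn a₁ a₂)ᶜ ∩ (openConn a₁ a₃)ᶜ : Set (BondConfig (Fin n)))) * (prodBernoulli w).real ((openConn a₂ a₁)ᶜ ∩ (openConn a₂ a₃)ᶜ : Set (BondConfig (Fin n))) * (prodBernoulli w).real ((openConn a₃ a₁)ᶜ ∩ (openConn a₃ a₂)ᶜ : Set (BondConfig (Fin n)))) + ((prodBernoulli w).real (openConn o a₂ ∩ ((openConn a₂ a₁)ᶜ ∩ (openConn a₂ a₃)ᶜ : Set (BondConfig (Fin n)))) * (prodBernoulli w).real ((openConn a₁ a₂)ᶜ ∩ (openConn a₁ a₃)ᶜ : Set (BondConfig (Fin n))) * (prodBernoulli w).real ((openConn a₃ a₁)ᶜ ∩ (openConn a₃ a₂)ᶜ : Set (BondConfig (Fin n)))) + ((prodBernoulli w).real (openConn o a₃ ∩ ((openConn a₃ a₁)ᶜ ∩ (openConn a₃ a₂)ᶜ : Set (BondConfig (Fin n)))) * (prodBernoulli w).real ((openConn a₁ a₂)ᶜ ∩ (openConn a₁ a₃)ᶜ : Set (BondConfig (Fin n))) * (prodBernoulli w).real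 ((openConn a₂ a₁)ᶜ ∩ (openConn a₂ a₃)ᶜ : Set (BondConfig (Fin n)))) = 0 := by
      push Not at hS
      linarith
    have e1 : ((prodBernoulli w).real (openConn o a₁ ∩ ((openConn a₁ a₂)ᶜ ∩ (openConn a₁ a₃)ᶜ : Set (BondConfig (Fin n)))) * (prodBernoulli w).real ((openConn a₂ a₁)ᶜ ∩ (openConn a₂ a₃)ᶜ : Set (BondConfig (Fin n))) * (prodBernoulli w).real ((openConn a₃ a₁)ᶜ ∩ (openConn a₃ a₂)ᶜ : Set (BondConfig (Fin n)))) = 0 := by linarith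
    have e2 : ((prodBernoulli w).real (openConn o a₂ ∩ ((openConn a₂ a₁)ᶜ ∩ (openConn a₂ a₃)ᶜ : Set (BondConfig (Fin n)))) * (prodBernoulli w).real ((openConn a₁ a₂)ᶜ ∩ (openConn a₁ a₃)ᶜ : Set (BondConfig (Fin n))) * (prodBernoulli w).real ((openConn a₃ a₁)ᶜ ∩ (openConn a₃ a₂)ᶜ : Set (BondConfig (Fin n)))) = 0 := by linarith
    have e3 : ((prodBernoulli w).real (openConn o a₃ ∩ ((openConn a₃ a₁)ᶜ ∩ (openConn a₃ a₂)ᶜ : Set (BondConfig (Fin n)))) * (prodBernoulli w).real ((openConn a₁ a₂)ᶜ ∩ (openConn a₁ a₃)ᶜ : Set (BondConfig (Fin n))) * (prodBernoulli w).real ((openConn a₂ a₁)ᶜ ∩ (openConn a₂ a₃)ᶜ : Set (BondConfig (Fin n)))) = 0 := by linarith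
    have hz1 : (prodBernoulli w).real (openConn o a₁ ∩ ((openConn a₁ a₂)ᶜ ∩ (openConn a₁ a₃)ᶜ : Set (BondConfig (Fin n)))) = 0 := by
      rcases mul_eq_zero.mp e1 with h | h
      · rcases mul_eq_zero.mp h with h' | h'
        · exact h'
        · exact absurd h' (ne_of_gt hN2)
      · exact absurd h (ne_of_gt hN3)
    have hz2 : (prodBernoulli w).real (openConn o a₂ ∩ ((openConn a₂ a₁)ᶜ ∩ (openConn a₂ a₃)ᶜ : Set (BondConfig (Fin n)))) = 0 := by
      rcases mul_eq_zero.mp e2 with h | h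
      · rcases mul_eq_zero.mp h with h' | h'
        · exact h'
        · exact absurd h' (ne_of_gt hN1)
      · exact absurd h (ne_of_gt hN3)
    have hz3 : (prodBernoulli w).real (openConn o a₃ ∩ ((openConn a₃ a₁)ᶜ ∩ (openConn a₃ a₂)ᶜ : Set (BondConfig (Fin n)))) = 0 := by
      rcases mul_eq_zero.mp e3 with h | h
      · rcases mul_eq_zero.mp h with h' | h'
        · exact h'
        · exact absurd h' (ne_of_gt hN1)
      · exact absurd h (ne_of_gt hN2)
    exact tiedRaiseThreeInf_of_zeroPhi w o b a₁ a₂ a₃ x₁₂ x₁₃ x₂₃ ρ h12 h13 h23 ht12 ht13 hx12 hx13 hx23 hr1 hw12 hw13 hw23 hz1 hz2 hz3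

end

end Summit.CriticalPhenomena.PercolationContinuityZ3.Theorems
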